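import Summits.HodgeConjecture.HodgeConjecture.Theorems.R90S6BCPartnerOnGenerators   -- ★ W10-c (B.1)(B.1′)(B.2)(B.3)(B.3′) `bcGraphPartnerAlgHom_heckeDiag_one/_one_eq_basic/_two/_three/_three_inv`
import Summits.HodgeConjecture.HodgeConjecture.Theorems.R90S6GLThreePieri           -- ★ W10-f (H.1)(H.2) + §1 Cartan letters (central shift, `t_r = ϖ^{…}`, `c_0 = 1`)
import HarnessLib

/-!
# R90 · S6 «Ch. 14.1–14.5 stable TF» — WAVE 10 card W10-g (= W10-f (H.3)(H.4)) «b ON THE BASIS, n = 3»: THE `b`-RECURSION FOR `B_ν := b(c_ν)` —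
# THE `GL₃` PIERI RULE PUSHED THROUGH `b = bcGraphPartnerAlgHom` (`Theorems/R90S6BCPartnerRecursion.lean`; row E1.4.4.2.3 «bφ_λ = Σ_m c_{λ,m} φ_m»)

Cell `hodgecm-mathlib`, crux H413 (`stmt-HodgeConjecture-24833`), route of record `HCCMUnconditional`; programme R90-TF, section S6 (base `R90-C14`),
seat R90-C14-p06 (g0); S6 dealer R90-C14-plan (g2) CARD W10-f (R90 bus 2026-09-05T00:45:01Z: «b is an algebra hom with b T₁ = b T₂ = φ₁ + (Q − √Q + 1)•1,
b T₃^{±1} = 1 (★ W10-c), so the GL₃ PIERI RULE … pushed through b gives a LINEAR RECURSION for B_{a,b} := b(c_{(a,b,0)}) driven by multiplication by φ₁ in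
ℋ(U₃)»; (H.3) the recursion, (H.4) the bases `B_{1,0} = B_{1,1} = b T₁ = φ₁ + (Q − √Q + 1)•1`, `B_{0,0} = 1`) + RULING R1 (00:49:11Z).  Sequel of ★
`R90S6BCPartnerOnGenerators` (p863729) and ★ `R90S6GLThreePieri` ((H.1)(H.2), support as a binder per dealer 01:19:53Z).  Everything `U(3)`-side is pushed
through OPAQUE-LETTER algebra (`algHom_mul_eq_sum_smul_of_eq` & co.: `map_mul`∕`map_sum`∕`map_smul` on abstract `A →ₐ[ℂ] B`, then `exact` — no tactic ever
compares the concrete `GL₃` and `U(3)` carriers, cf. ★ W10-c's heartbeat notes).  Lane `--supports stmt-HodgeConjecture-24833 --as helper`; THEOREMS ONLY;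
letters = ★ p09 `bcGraphPartnerAlgHom c hc1 v w hw hv hϖ hu hwt` VERBATIM, `B_ν := bcGraphPartnerAlgHom … (c_ν)`, `c_ν = doubleCosetOperator (glInt 3 K) (zpowDiagGL hϖ.ne_zero ν)`.

§1 OPAQUE-LETTER ALGEBRA: `algHom_mul_eq_sum_smul_of_eq`, `algHom_map_mul_of_map_eq_one`.
§2 (H.4) BASES AND THE CENTRAL COLLAPSE: **`bcGraphPartnerAlgHom_cartan_zero`** (`B_0 = 1`), **`bcGraphPartnerAlgHom_cartan_add_one`** (`B_{ν + 𝟙} = B_ν`: ★ central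
shift + (B.3) `b T₃ = 1` — so `B` is a function of `(ν₀ − ν₂, ν₁ − ν₂)`, the dealer's two-parameter family `B_{a,b}`), **`bcGraphPartnerAlgHom_cartan_single_zero`**
(`B_{e₀} = b T₁`), **`bcGraphPartnerAlgHom_cartan_one_sub_single_two`** (`B_{𝟙 − e₂} = b T₂ = b T₁`, (B.2)), **`bcGraphPartnerAlgHom_cartan_single_zero_eq_basic`**
(`B_{e₀} = φ₁ + (Q − √Q + 1) • 1` in the raw letters of the junction `K = L_w`, (B.1′), under its `hd`∕`hqQ` binders), **`bcGraphPartnerAlgHom_cartan_one`** (`B_{𝟙} = 1`).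
§3 (H.3) THE RECURSION: **`bcGraphPartnerAlgHom_mul_eq_sum_of_eq`** (push of ANY `GL₃` expansion `x · y = Σ a_i • c_{ν_i}`), **`bcGraphPartnerAlgHom_cartan_mul_heckeDiag_one`**
(`B_μ · b T₁ = Σ_{i : μ + e_i antitone} N₁(μ, μ + e_i) • B_{μ + e_i}`, support binder `hS` as in (H.1)), **`bcGraphPartnerAlgHom_cartan_mul_heckeDiag_two`** (the `T₂` twin,
OMITTED-row indexing).  With p10's closed forms (`N₁(μ, μ + e₀) = 1` leading) these solve for `B_{μ + e₀}` ∕ `B_{μ + 𝟙 − e₂}`: the linear recursion of the card, driven by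
`b T₁ = φ₁ + (Q − √Q + 1)•1` and ★ F1∕F2′∕F4 on the `U(3)` side — assembled in the explicit sequel once L3 is ★.

HONEST LABEL: coefficient bookkeeping for E1.4.4.2.3, count-neutral until the BC identity consumes it; support binders OPEN (p10 L3); HC_CM is proved only modulo the
7 printed citations (2 remaining named inputs: hLiu418 = stmt-HodgeConjecture-24832, h413 = stmt-HodgeConjecture-24833) until rung 0 closes; REL ≠ ★ ≠ BUILT.

## References
* [Rogawski1990] J. Rogawski, *Automorphic Representations of Unitary Groups in Three Variables* (1990), §4.10 Prop. 4.10.2 p. 58 (`b` on unramified Hecke algebras).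
* [Macdonald1995] I. G. Macdonald, *Symmetric Functions and Hall Polynomials*, 2nd ed. (1995), Ch. II (4.6), Ch. V (2.5)–(2.6).
* [CartierCorvallis1979] P. Cartier, Corvallis 1979, §IV (4.2), Cor. 4.2.
-/

set_option autoImplicit false
-- the mandated namespace repeats the single-problem summit's segment (`HodgeConjecture.HodgeConjecture`)
set_option linter.dupNamespace false

noncomputable section

open MulAction
open NumberField IsDedekindDomain
open Literature.NumberTheory.Automorphic Literature.NumberTheory.Automorphic.HermitianLattice Literature.NumberTheory.Automorphic.UnitaryGroup
open Literature.NumberTheory.Automorphic.CartanUnique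
open scoped MatrixGroups
open ValuativeRel

namespace Summit.HodgeConjecture.HodgeConjecture.R90.S6

universe u

/-! ## §1 Opaque-letter algebra -/

section Algebra

variable {A B : Type*} [Semiring A] [Semiring B] [Algebra ℂ A] [Algebra ℂ B] (f : A →ₐ[ℂ] B)

/-- `f x · f y = Σ a_i • f z_i` from `x · y = Σ a_i • z_i`, for an algebra homomorphism `f` (opaque letters, so that `exact` never unfolds carriers). [folklore] -/
theorem algHom_mul_eq_sum_smul_of_eq {ι : Type*} (s : Finset ι) (a : ι → ℂ) (z : ι → A) {x y : A}
    (h : x * y = ∑ i ∈ s, a i • z i) : f x * f y = ∑ i ∈ s, a i • f (z i) := by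
  rw [← map_mul, h, map_sum]
  exact Finset.sum_congr rfl fun i _ => map_smul f (a i) (z i)

/-- `f (z · x) = f x` when `f z = 1`. [folklore] -/
theorem algHom_map_mul_of_map_eq_one {z : A} (hz : f z = 1) (x : A) : f (z * x) = f x := by
  rw [map_mul, hz, one_mul]

end Algebra

/-! ## §2 (H.4) bases and the central collapse; §3 (H.3) the recursion -/

section Partner

variable {F E : Type} [Field F] [NumberField F] [Field E] [NumberField E] [Algebra F E] [Algebra.IsQuadraticExtension F E]
  (c : E ≃ₐ[F] E) (hc1 : c ≠ 1) (v : HeightOneSpectrum (𝓞 F)) (w : PlacesOver E v) (hw : c • w.1 = w.1)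
  (hv : Algebra.IsUnramifiedIn (𝓞 E) v.asIdeal)
  {K : Type u} [Field K] [ValuativeRel K] [IsDiscreteValuationRing 𝒪[K]] [Finite 𝓀[K]] {ϖ : K}
  [IsHeckeTriple (⊤ : Submonoid (GL (Fin 3) K)) (glInt 3 K) (glInt 3 K)]
  (hϖ : IsUniformizingElement ϖ) {u : ℂˣ} (hu : (u : ℂ) ^ 2 = ((Nat.card 𝓀[K] : ℕ) : ℂ))
  {wt : Multiplicative (Fin 3 → ℤ) →* ℂ}
  (hwt : ∀ e : Fin 3 → ℤ, wt (Multiplicative.ofAdd e) = ((u ^ ((((3 : ℕ) : ℤ) - 1) * (∑ i, e i) - 2 * satakeTwistExp e) : ℂˣ) : ℂ))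

/-- **(H.4.0) `B_0 = 1`** (`c_0 = 1`, `b` unital). [cite: Rogawski1990, §4.10 Prop. 4.10.2 p. 58] -/
theorem bcGraphPartnerAlgHom_cartan_zero :
    bcGraphPartnerAlgHom c hc1 v w hw hv hϖ hu hwt
        (heckeAlgebra.doubleCosetOperator (glInt 3 K) (zpowDiagGL hϖ.ne_zero (0 : Fin 3 → ℤ))) = 1 := by
  rw [doubleCosetOperator_zpowDiagGL_zero hϖ, map_one]

/-- **(H.4.c) CENTRAL COLLAPSE `B_{ν + 𝟙} = B_ν`** (★ central shift `c_{ν+𝟙} = T₃ · c_ν` and (B.3) `b T₃ = 1`): `B_ν` only depends on `(ν₀ − ν₂, ν₁ − ν₂)` — the dealer's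
two-parameter family `B_{a,b} = B_{(a,b,0)}`. [cite: Rogawski1990, §4.10 Prop. 4.10.2 p. 58] [cite: Macdonald1995, Ch. V (2.5)] -/
theorem bcGraphPartnerAlgHom_cartan_add_one (ν : Fin 3 → ℤ) :
    bcGraphPartnerAlgHom c hc1 v w hw hv hϖ hu hwt
        (heckeAlgebra.doubleCosetOperator (glInt 3 K) (zpowDiagGL hϖ.ne_zero (ν + 1))) =
      bcGraphPartnerAlgHom c hc1 v w hw hv hϖ hu hwt
        (heckeAlgebra.doubleCosetOperator (glInt 3 K) (zpowDiagGL hϖ.ne_zero ν)) := by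
  rw [doubleCosetOperator_zpowDiagGL_add_one hϖ ν]
  exact algHom_map_mul_of_map_eq_one _ (bcGraphPartnerAlgHom_heckeDiag_three c hc1 v w hw hv hϖ hu hwt) _

/-- **(H.4.c′) `B_{𝟙} = 1`.** [cite: Rogawski1990, §4.10 Prop. 4.10.2 p. 58] -/
theorem bcGraphPartnerAlgHom_cartan_one :
    bcGraphPartnerAlgHom c hc1 v w hw hv hϖ hu hwt
        (heckeAlgebra.doubleCosetOperator (glInt 3 K) (zpowDiagGL hϖ.ne_zero (1 : Fin 3 → ℤ))) = 1 := by
  rw [← heckeDiag_three_eq_zpowDiagGL_one hϖ, bcGraphPartnerAlgHom_heckeDiag_three]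

/-- **(H.4.1) `B_{e₀} = b T₁`** (`t₁ = ϖ^{e₀}`). [cite: Rogawski1990, §4.10 Prop. 4.10.2 p. 58] -/
theorem bcGraphPartnerAlgHom_cartan_single_zero :
    bcGraphPartnerAlgHom c hc1 v w hw hv hϖ hu hwt
        (heckeAlgebra.doubleCosetOperator (glInt 3 K) (zpowDiagGL hϖ.ne_zero (Pi.single 0 1))) =
      bcGraphPartnerAlgHom c hc1 v w hw hv hϖ hu hwt
        (heckeAlgebra.doubleCosetOperator (glInt 3 K) (heckeDiag 3 (Units.mk0 ϖ hϖ.ne_zero) 1)) := by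
  rw [heckeDiag_one_eq_zpowDiagGL_single hϖ]

/-- **(H.4.2) `B_{𝟙 − e₂} = b T₂ = b T₁`** (`t₂ = ϖ^{𝟙 − e₂}`, (B.2)). [cite: Rogawski1990, §4.10 Prop. 4.10.2 p. 58] -/
theorem bcGraphPartnerAlgHom_cartan_one_sub_single_two :
    bcGraphPartnerAlgHom c hc1 v w hw hv hϖ hu hwt
        (heckeAlgebra.doubleCosetOperator (glInt 3 K) (zpowDiagGL hϖ.ne_zero (1 - Pi.single 2 1))) =
      bcGraphPartnerAlgHom c hc1 v w hw hv hϖ hu hwt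
        (heckeAlgebra.doubleCosetOperator (glInt 3 K) (heckeDiag 3 (Units.mk0 ϖ hϖ.ne_zero) 1)) := by
  rw [← heckeDiag_two_eq_zpowDiagGL hϖ, bcGraphPartnerAlgHom_heckeDiag_two]

/-- **(H.4.1′) `B_{e₀} = φ₁ + (Q − √Q + 1) • 1` IN THE RAW LETTERS OF THE JUNCTION `K = L_w`** ((H.4.1) + ★ (B.1′) `bcGraphPartnerAlgHom_heckeDiag_one_eq_basic`, under
its datum `hd` and the residue-cardinality identity `hqQ`). [cite: Rogawski1990, §4.10 Prop. 4.10.2 p. 58] [cite: CartierCorvallis1979, §IV (4.2), Cor. 4.2] -/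
theorem bcGraphPartnerAlgHom_cartan_single_zero_eq_basic {ϖ' : w.1.adicCompletion E}
    (hd : UnramifiedLocalConjDatum (galAdicCompletionMap (L := E) c hw) ϖ')
    (hqQ : ((Nat.card 𝓀[K] : ℕ) : ℂ) = (Nat.card (Valued.ResidueField (w.1.adicCompletion E)) : ℂ)) :
    haveI := isHeckeTriple_unitaryInt_adicCompletion c v w hw ((StdForm.antidiagonal 3).over (w.1.adicCompletion E))
    bcGraphPartnerAlgHom c hc1 v w hw hv hϖ hu hwt
        (heckeAlgebra.doubleCosetOperator (glInt 3 K) (zpowDiagGL hϖ.ne_zero (Pi.single 0 1))) =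
      heckeAlgebra.doubleCosetOperator
          (unitaryInt (galAdicCompletionMap (L := E) c hw) ((StdForm.antidiagonal 3).over (w.1.adicCompletion E)))
          (⟨zpowDiagGL (uniformizer_ne_zero hd.vϖ) (fun i : Fin 3 => (1 : ℤ) * (1 - (i : ℕ))),
            zpowDiagGL_mem_unitaryGroupOfForm hd.σϖ _ (rev_linear_three 1)⟩ :
            ↥(unitaryGroupOfForm (galAdicCompletionMap (L := E) c hw) ((StdForm.antidiagonal 3).over (w.1.adicCompletion E)))) +
        ((Nat.card (Valued.ResidueField (w.1.adicCompletion E)) : ℂ) -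
            (Nat.sqrt (Nat.card (Valued.ResidueField (w.1.adicCompletion E))) : ℂ) + 1) • 1 := by
  exact (bcGraphPartnerAlgHom_cartan_single_zero c hc1 v w hw hv hϖ hu hwt).trans
    (bcGraphPartnerAlgHom_heckeDiag_one_eq_basic c hc1 v w hw hv hϖ hu hwt hd hqQ)

/-- **(H.3-push) ANY `GL₃` EXPANSION `x · y = Σ a_i • c_{ν_i}` BECOMES `b x · b y = Σ a_i • B_{ν_i}`** (opaque-letter `map_mul`∕`map_sum`∕`map_smul`).
[cite: Rogawski1990, §4.10 Prop. 4.10.2 p. 58] -/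
theorem bcGraphPartnerAlgHom_mul_eq_sum_of_eq {ι : Type*} (s : Finset ι) (a : ι → ℂ) (ν : ι → Fin 3 → ℤ)
    {x y : heckeAlgebra ℂ (GL (Fin 3) K) (glInt 3 K)}
    (h : x * y = ∑ i ∈ s, a i • heckeAlgebra.doubleCosetOperator (glInt 3 K) (zpowDiagGL hϖ.ne_zero (ν i))) :
    bcGraphPartnerAlgHom c hc1 v w hw hv hϖ hu hwt x * bcGraphPartnerAlgHom c hc1 v w hw hv hϖ hu hwt y =
      ∑ i ∈ s, a i • bcGraphPartnerAlgHom c hc1 v w hw hv hϖ hu hwt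
        (heckeAlgebra.doubleCosetOperator (glInt 3 K) (zpowDiagGL hϖ.ne_zero (ν i))) :=
  algHom_mul_eq_sum_smul_of_eq _ s a _ h

/-- **(H.3) THE `b`-RECURSION, `r = 1`: `B_μ · b T₁ = Σ_{i : μ + e_i antitone} N₁(μ, μ + e_i) • B_{μ + e_i}`** ((H.1) pushed through `b`; support binder `hS` =
p10's L3, as in ★ (H.1)).  With `N₁(μ, μ + e₀) = 1` (p10's (P1)) this solves for `B_{μ + e₀}`: the linear recursion of the card, driven by `b T₁ = φ₁ + (Q − √Q + 1)•1`.
[cite: Rogawski1990, §4.10 Prop. 4.10.2 p. 58] [cite: Macdonald1995, Ch. II (4.6), Ch. V (2.6)] -/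
theorem bcGraphPartnerAlgHom_cartan_mul_heckeDiag_one (μ : Fin 3 → ℤ)
    (hS : ∀ ν : Fin 3 → ℤ, Antitone ν →
      ({γ ∈ MulAction.orbit (glInt 3 K) ((heckeDiag 3 (Units.mk0 ϖ hϖ.ne_zero) 1 : GL (Fin 3) K) : GL (Fin 3) K ⧸ glInt 3 K) |
          ((γ.out⁻¹ * zpowDiagGL hϖ.ne_zero ν : GL (Fin 3) K) : GL (Fin 3) K ⧸ glInt 3 K) ∈
            MulAction.orbit (glInt 3 K) ((zpowDiagGL hϖ.ne_zero μ : GL (Fin 3) K) : _ ⧸ _)}).ncard ≠ 0 →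
      ∃ i : Fin 3, ν = μ + Pi.single i 1) :
    bcGraphPartnerAlgHom c hc1 v w hw hv hϖ hu hwt (heckeAlgebra.doubleCosetOperator (glInt 3 K) (zpowDiagGL hϖ.ne_zero μ)) *
        bcGraphPartnerAlgHom c hc1 v w hw hv hϖ hu hwt (heckeAlgebra.doubleCosetOperator (glInt 3 K) (heckeDiag 3 (Units.mk0 ϖ hϖ.ne_zero) 1)) =
      ∑ i ∈ Finset.univ.filter (fun i : Fin 3 => Antitone (μ + Pi.single i 1)),
        (({γ ∈ MulAction.orbit (glInt 3 K) ((heckeDiag 3 (Units.mk0 ϖ hϖ.ne_zero) 1 : GL (Fin 3) K) : GL (Fin 3) K ⧸ glInt 3 K) |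
            ((γ.out⁻¹ * zpowDiagGL hϖ.ne_zero (μ + Pi.single i 1) : GL (Fin 3) K) : GL (Fin 3) K ⧸ glInt 3 K) ∈
              MulAction.orbit (glInt 3 K) ((zpowDiagGL hϖ.ne_zero μ : GL (Fin 3) K) : _ ⧸ _)}).ncard : ℂ) •
          bcGraphPartnerAlgHom c hc1 v w hw hv hϖ hu hwt
            (heckeAlgebra.doubleCosetOperator (glInt 3 K) (zpowDiagGL hϖ.ne_zero (μ + Pi.single i 1))) :=
  bcGraphPartnerAlgHom_mul_eq_sum_of_eq c hc1 v w hw hv hϖ hu hwt _ _ (fun i : Fin 3 => μ + Pi.single i 1)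
    (doubleCosetOperator_zpowDiagGL_mul_heckeDiag_one_three hϖ μ hS)

/-- **(H.3) THE `b`-RECURSION, `r = 2`: `B_μ · b T₂ = Σ_{i : μ + 𝟙 − e_i antitone} N₂(μ, μ + 𝟙 − e_i) • B_{μ + 𝟙 − e_i}`** ((H.2) pushed through `b`; recall `b T₂ = b T₁`
by (B.2)). [cite: Rogawski1990, §4.10 Prop. 4.10.2 p. 58] [cite: Macdonald1995, Ch. II (4.6), Ch. V (2.6)] -/
theorem bcGraphPartnerAlgHom_cartan_mul_heckeDiag_two (μ : Fin 3 → ℤ)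
    (hS : ∀ ν : Fin 3 → ℤ, Antitone ν →
      ({γ ∈ MulAction.orbit (glInt 3 K) ((heckeDiag 3 (Units.mk0 ϖ hϖ.ne_zero) 2 : GL (Fin 3) K) : GL (Fin 3) K ⧸ glInt 3 K) |
          ((γ.out⁻¹ * zpowDiagGL hϖ.ne_zero ν : GL (Fin 3) K) : GL (Fin 3) K ⧸ glInt 3 K) ∈
            MulAction.orbit (glInt 3 K) ((zpowDiagGL hϖ.ne_zero μ : GL (Fin 3) K) : _ ⧸ _)}).ncard ≠ 0 →
      ∃ i : Fin 3, ν = μ + 1 - Pi.single i 1) :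
    bcGraphPartnerAlgHom c hc1 v w hw hv hϖ hu hwt (heckeAlgebra.doubleCosetOperator (glInt 3 K) (zpowDiagGL hϖ.ne_zero μ)) *
        bcGraphPartnerAlgHom c hc1 v w hw hv hϖ hu hwt (heckeAlgebra.doubleCosetOperator (glInt 3 K) (heckeDiag 3 (Units.mk0 ϖ hϖ.ne_zero) 2)) =
      ∑ i ∈ Finset.univ.filter (fun i : Fin 3 => Antitone (μ + 1 - Pi.single i 1)),
        (({γ ∈ MulAction.orbit (glInt 3 K) ((heckeDiag 3 (Units.mk0 ϖ hϖ.ne_zero) 2 : GL (Fin 3) K) : GL (Fin 3) K ⧸ glInt 3 K) |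
            ((γ.out⁻¹ * zpowDiagGL hϖ.ne_zero (μ + 1 - Pi.single i 1) : GL (Fin 3) K) : GL (Fin 3) K ⧸ glInt 3 K) ∈
              MulAction.orbit (glInt 3 K) ((zpowDiagGL hϖ.ne_zero μ : GL (Fin 3) K) : _ ⧸ _)}).ncard : ℂ) •
          bcGraphPartnerAlgHom c hc1 v w hw hv hϖ hu hwt
            (heckeAlgebra.doubleCosetOperator (glInt 3 K) (zpowDiagGL hϖ.ne_zero (μ + 1 - Pi.single i 1))) :=
  bcGraphPartnerAlgHom_mul_eq_sum_of_eq c hc1 v w hw hv hϖ hu hwt _ _ (fun i : Fin 3 => μ + 1 - Pi.single i 1)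
    (doubleCosetOperator_zpowDiagGL_mul_heckeDiag_two_three hϖ μ hS)

end Partner

end Summit.HodgeConjecture.HodgeConjecture.R90.S6

end
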